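import Summits.BirchSwinnertonDyer.BirchSwinnertonDyer.Theorems.ManinLocalTwoThreeKummerWitnessInvarianceDensity
import Summits.BirchSwinnertonDyer.BirchSwinnertonDyer.Theorems.ManinLocalTwoThreeKummerCubeRootCuspGrowth
import Literature.NumberTheory.EllipticCurves.ModularCurveManinConstantProofs
import HarnessLib

/-!
# (INV) PROVED: the `Γ₀(N)`-stabiliser of the Kummer witness is exactly the Kummer group
(route `ManinLocalTwoThree`, crux C3 `ManinPrimeToThreeAtNine` stmt-BirchSwinnertonDyer-22968; cell bsd-f2-manin, p2 gen 17;
`--supports stmt-BirchSwinnertonDyer-22968`)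

**`kummerMinimalWitnessInvariance_holds : UDCKummerWitnessLine.KummerMinimalWitnessInvariance`** — -an g38's typed piece (INV) of the witness law
`stub_kummerCubeRootModularFormWitness` (p729921), BY NAME: for `u ∉ Λ`, `3u = m₁ω₁ + m₂ω₂`, `P ≠ 0`, `C₀ ≠ 0` and a holomorphic `F` equal to
`C₀·kummerMinBlock D u e·kummerPoleKiller P n` on the good set `{w ∉ Λ, y_W∘φ ≠ 0}`, and `γ ∈ Γ₀(N)`:
`KummerPeriodTrivial D u γ ⟺ F ∣[12·n·deg P] γ = F`.
Proof.  `slash_eq_smul`: `F ∣ γ = ρ_γ·F` on ALL of `ℍ` for any multiplier `ρ_γ` of `W_{u,e}` along `μ_γ` — on the good set by (INV-a)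
`slash_apply_eq_mul_of_good`, at the remaining (isolated, (INV-b) `eventually_good`) points by continuity.  `⟹`: Kummer-trivial periods have `ρ_γ = 1`
(p3 `sigmaCubeRoot_periodic_iff`).  `⟸`: `F ≢ 0` (`exists_apply_ne_zero`: block `= −2A(w)e^{ew/3}/Q(w)` with `A, Q` entire, `A(0)Q(0) ≠ 0`, and the
killer vanishes on no punctured disc, (INV-b)), so `F = ρ_γF` forces `ρ_γ = 1`, i.e. `W_{u,e}` is `μ_γ`-periodic, i.e. `KummerPeriodTrivial` (p3's iff).
`D.c ≠ 0` and `D.f ≠ 0` come from the datum (tree `maninConstant_ne_zero_holds`, `newform_ne_zero`).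
HONEST FRAMING.  One typed piece of the (AN) witness law is now a theorem; (ALG), (DICT), (EXT), (QEXN) remain ((INT), (QXP) closed by name).  BSD is
not proved by this; Manin's conjecture is not proved; C2 and C3 remain OPEN.
[folklore]
-/

set_option autoImplicit false
-- lint-debt: the directory name repeats the summit name (sibling precedent `ManinLocalTwoThreeKummerCubeRootSigmaAutomorphy.lean`)
set_option linter.dupNamespace false

noncomputable section

open scoped Topology PeriodPair MatrixGroups Manifold ModularForm
open Complex Filter CongruenceSubgroup
open UpperHalfPlane hiding I
open Literature.NumberTheory.EllipticCurves Literature.NumberTheory.EllipticCurves.ModularForms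
open Summit.BirchSwinnertonDyer.Rank1Residual.ManinAdditive.KummerCubeMonodromy
open Summit.BirchSwinnertonDyer.Rank1Residual.ManinAdditive.UDCKummerLine
open Summit.BirchSwinnertonDyer.Rank1Residual.ManinAdditive.UDCKummerWitnessLine
open Summit.BirchSwinnertonDyer.BirchSwinnertonDyer.Theorems.ManinLocalTwoThree.KummerCubeRootDictionary
open Summit.BirchSwinnertonDyer.BirchSwinnertonDyer.Theorems.ManinLocalTwoThree.KummerCover

namespace Summit.BirchSwinnertonDyer.BirchSwinnertonDyer.Theorems.ManinLocalTwoThree.WitnessInvariance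

variable {W : WeierstrassCurve ℚ} {N : ℕ} [NeZero N]

/-! ### §1 `F ∣ γ = ρ_γ·F` on all of `ℍ` -/

/-- **`F ∣[12·n·deg P] γ = ρ·F` everywhere**, for a holomorphic `F` given by `C₀·block·killer` on the good set and any multiplier `ρ` of `W_{u,e}`
along `μ_γ` (good set by (INV-a), the isolated bad points by continuity). [folklore] -/
theorem slash_eq_smul (D : ModularParametrizationData W N) (hc0 : D.c ≠ 0) (hf : D.f ≠ 0) (u e : ℂ) (P : Polynomial ℤ) (n : ℕ)
    (C₀ : ℂ) {F : ℍ → ℂ} (hFd : MDifferentiable 𝓘(ℂ) 𝓘(ℂ) F)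
    (hF : ∀ τ : ℍ, (D.c : ℂ) * eichlerIntegral D.f τ ∉ D.L.lattice → minimalY D τ ≠ 0 →
      F τ = C₀ * kummerMinBlock D u e τ * kummerPoleKiller P n τ)
    (γ : Gamma0 N) {ρ : ℂ} (hρ : ∀ w : ℂ, sigmaCubeRoot D.L u e (w + (D.c : ℂ) * cuspSymbol D.f γ) = ρ * sigmaCubeRoot D.L u e w) :
    F ∣[((12 * n * P.natDegree : ℕ) : ℤ)] (γ : SL(2, ℤ)) = ρ • F := by
  funext τ₀
  have hG : MDifferentiable 𝓘(ℂ) 𝓘(ℂ) (F ∣[((12 * n * P.natDegree : ℕ) : ℤ)] (γ : SL(2, ℤ))) := by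
    rw [ModularForm.SL_slash]
    exact hFd.slash _ _
  have h1 : ContinuousAt ((F ∣[((12 * n * P.natDegree : ℕ) : ℤ)] (γ : SL(2, ℤ))) ∘ ofComplex) (τ₀ : ℂ) :=
    (UpperHalfPlane.mdifferentiableAt_iff.mp (hG τ₀)).continuousAt
  have h2 : ContinuousAt (fun z : ℂ => ρ * (F ∘ ofComplex) z) (τ₀ : ℂ) :=
    continuousAt_const.mul (UpperHalfPlane.mdifferentiableAt_iff.mp (hFd τ₀)).continuousAt
  have heq : ((F ∣[((12 * n * P.natDegree : ℕ) : ℤ)] (γ : SL(2, ℤ))) ∘ ofComplex) =ᶠ[𝓝[≠] (τ₀ : ℂ)]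
      fun z : ℂ => ρ * (F ∘ ofComplex) z := by
    filter_upwards [eventually_good D hc0 hf τ₀] with z hz
    simp only [Function.comp_apply]
    exact slash_apply_eq_mul_of_good D u e P n C₀ hF γ hρ (ofComplex z) hz.1 hz.2
  have hlim := tendsto_nhds_unique_of_eventuallyEq (h1.tendsto.mono_left nhdsWithin_le_nhds)
    (h2.tendsto.mono_left nhdsWithin_le_nhds) heq
  simpa only [Function.comp_apply, ofComplex_apply, Pi.smul_apply, smul_eq_mul] using hlim

/-! ### §2 The witness is not identically zero -/

/-- **`F ≢ 0`**: near any point the good set has full punctured measure, the block is `−2A(w)e^{ew/3}/Q(w)` with `A(w)Q(w) ≠ 0` off isolated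
points, and the killer vanishes on no punctured disc. [folklore] -/
theorem exists_apply_ne_zero (D : ModularParametrizationData W N) (hc0 : D.c ≠ 0) (hf : D.f ≠ 0) {u : ℂ} (hu : u ∉ D.L.lattice)
    (e : ℂ) {P : Polynomial ℤ} (hP : P ≠ 0) (n : ℕ) {C₀ : ℂ} (hC₀ : C₀ ≠ 0) {F : ℍ → ℂ}
    (hF : ∀ τ : ℍ, (D.c : ℂ) * eichlerIntegral D.f τ ∉ D.L.lattice → minimalY D τ ≠ 0 →
      F τ = C₀ * kummerMinBlock D u e τ * kummerPoleKiller P n τ) :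
    ∃ τ : ℍ, F τ ≠ 0 := by
  by_contra hcon
  simp only [not_exists, not_not] at hcon
  obtain ⟨Q, A, hQd, hAd, hQ0, hA0, hY, hblock⟩ := exists_minimal_package D hc0 u e
  have hc : (D.c : ℂ) ≠ 0 := Int.cast_ne_zero.mpr hc0
  have hσ : Differentiable ℂ D.L.weierstrassSigma := D.L.differentiable_weierstrassSigma_holds
  have hσu : D.L.weierstrassSigma (-u) ≠ 0 := fun h =>
    hu (by simpa using D.L.lattice.neg_mem ((D.L.weierstrassSigma_eq_zero_iff_holds (-u)).mp h))
  have hZ : Differentiable ℂ (fun w => D.L.weierstrassSigma w * (Q w * A w)) := hσ.mul (hQd.mul hAd)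
  have hne : ∃ w, D.L.weierstrassSigma w * (Q w * A w) ≠ 0 :=
    exists_sigma_mul_ne_zero D.L (hQd.mul hAd).continuous.continuousAt (by
      show Q 0 * A 0 ≠ 0
      rw [hQ0, hA0]; exact mul_ne_zero (by norm_num) hσu)
  have hev := eventually_comp_ne_zero D hc0 hf UpperHalfPlane.I hZ hne
  apply not_eventually_kummerPoleKiller_eq_zero hP n (z₀ := ((UpperHalfPlane.I : ℍ) : ℂ)) UpperHalfPlane.I.im_pos
  filter_upwards [hev] with z hz
  set w : ℂ := (D.c : ℂ) * eichlerIntegral D.f (ofComplex z) with hw_def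
  have hσw : D.L.weierstrassSigma w ≠ 0 := left_ne_zero_of_mul hz
  have hQw : Q w ≠ 0 := left_ne_zero_of_mul (right_ne_zero_of_mul hz)
  have hAw : A w ≠ 0 := right_ne_zero_of_mul (right_ne_zero_of_mul hz)
  have hw : w ∉ D.L.lattice := fun h => hσw ((D.L.weierstrassSigma_eq_zero_iff_holds _).mpr h)
  have hYne : minimalY D (ofComplex z) ≠ 0 := by
    rw [hY _ hw]
    exact div_ne_zero (mul_ne_zero (div_ne_zero (pow_ne_zero 3 hc) two_ne_zero) hQw) (pow_ne_zero 3 hσw)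
  have hFz := hF (ofComplex z) hw hYne
  rw [hcon, hblock _ hw hQw] at hFz
  have hblock_ne : -2 * A w * cexp (e * w / 3) / Q w ≠ 0 :=
    div_ne_zero (mul_ne_zero (mul_ne_zero (by norm_num) hAw) (Complex.exp_ne_zero _)) hQw
  exact (mul_eq_zero.mp hFz.symm).resolve_left (mul_ne_zero hC₀ hblock_ne)

/-! ### §3 (INV) by name -/

/-- **(INV) `KummerMinimalWitnessInvariance` holds.**  See the file header. [folklore] -/
theorem kummerMinimalWitnessInvariance_holds : KummerMinimalWitnessInvariance := by
  intro W _ _ N _ D u hu m₁ m₂ h3u P hP n C₀ hC₀ F hFd hF γ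
  have hc0 : D.c ≠ 0 := D.maninConstant_ne_zero_holds
  have hf : D.f ≠ 0 := newform_ne_zero D
  have h3u' : (m₁ : ℂ) * D.L.ω₁ + (m₂ : ℂ) * D.L.ω₂ = 3 * u := h3u.symm
  have hμ := smul_cuspSymbol_mem_lattice D γ
  obtain ⟨ρ, hρW, -⟩ := exists_multiplier_gamma D u (m₁ * D.L.η₁ + m₂ * D.L.η₂) γ
  constructor
  · intro hK
    have hper := (sigmaCubeRoot_periodic_iff D.L hu h3u' hμ).mpr hK
    have h := slash_eq_smul D hc0 hf u (m₁ * D.L.η₁ + m₂ * D.L.η₂) P n C₀ hFd hF γ (ρ := 1)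
      (fun w => by rw [hper w, one_mul])
    rw [h, one_smul]
  · intro hinv
    have hρF := slash_eq_smul D hc0 hf u (m₁ * D.L.η₁ + m₂ * D.L.η₂) P n C₀ hFd hF γ hρW
    obtain ⟨τ₁, hτ₁⟩ := exists_apply_ne_zero D hc0 hf hu (m₁ * D.L.η₁ + m₂ * D.L.η₂) hP n hC₀ hF
    have hρ1 : ρ = 1 := by
      have h := congrFun hρF τ₁
      rw [hinv, Pi.smul_apply, smul_eq_mul] at h
      -- `F τ₁ = ρ·F τ₁`, `F τ₁ ≠ 0`
      have h' : (ρ - 1) * F τ₁ = 0 := by linear_combination -h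
      have := (mul_eq_zero.mp h').resolve_right hτ₁
      exact (sub_eq_zero.mp this)
    refine (sigmaCubeRoot_periodic_iff D.L hu h3u' hμ).mp fun w => ?_
    rw [hρW w, hρ1, one_mul]

end Summit.BirchSwinnertonDyer.BirchSwinnertonDyer.Theorems.ManinLocalTwoThree.WitnessInvariance

end
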